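import Literature.IUT.HodgeTheaters.PiAvatarBaseKitNFInstances
import Literature.IUT.HodgeTheaters.PMBaseDischarge
import Literature.IUT.HodgeTheaters.InitialThetaDataTorsionMonodromyUnramified
import Literature.IUT.HodgeTheaters.PuncturedEllipticCoveringsArrowClaimsOfModLCuspLaws
import HarnessLib

/-!
# [IUTchI] Prop 6.5 (i) BY NAME at the genuine §6 base kits: `InducesZeta` (s.1) and `XiGroupCompat` (s.2) at `baseKitOfData`,
# `baseKit`, `baseKitOfTorsionMonodromy`, `baseKitOfBadPairs`, `baseKitStandIn`, `baseKitArrowStandIn`, the NF-widened kits, and at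
# the L5-certificate's unramified kit (proof-only; cone node IUTchI:Prop6.5(i); R-C discharge, abc-iut-w5-d086 gen 7)

S. Mochizuki, *Inter-universal Teichmüller theory I: construction of Hodge theaters*, kurims manuscript (May 2020), Prop 6.5 (i) pp. 163-164,
Ex 6.3 (i) p. 161 [claim: Mochizuki2012, status: disputed] (D-0012 claim key; series status DISPUTED — kernel theorems about abc-iut-L5-t4's
CONSTRUCTIONS over abc-iut-L5-t2's REAL `InitialThetaData`; nothing of the series is asserted, no side is taken on [IUTchIII] Cor. 3.12).

## Why this file
The four §6 cone rows held by the `SUBDAG-IUTchI-Prop65-Prop66` lineage are Prop 6.5 (i), 6.6 (ii), 6.6 (iii), 6.8 (i).  abc-iut-L5-t4's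
genuine-kit files (`PiAvatarBaseKitConsumers` p446174, `PiAvatarBaseKitOfTorsionMonodromy` p446463, `PiAvatarBaseKitStandIn` p448457,
`PiAvatarBadPairAtStandIn` p447892, `PiAvatarBaseKitNFInstances`) restate Prop 6.6 (ii)(iii), Prop 6.8 (i) and Ex 6.3 (ii) BY NAME at every
genuine kit, but NOT Prop 6.5 (i): its two named statements `PMBaseKit.DThetaEllBridge.InducesZeta` / `XiGroupCompat` (abc-iut-L5-t4
`PMBaseBridgeProps` p407837) were so far only inlined in the layer certificate (`Layer5OfSV09`/`V10`, (β) route with the parity side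
condition `l ≠ 2`).  This file supplies the missing by-name consumers, via the (α) route `PMBaseKit.DThetaEllBridge.xiGroupCompat_of_sync`
(abc-iut-L5-t13 `PMBaseDischarge`, NO parity condition) applied to the (α) laws `phiEllSync_baseKit*` PROVED by abc-iut-L5-t4 at each kit;
the first sentence is abc-iut-L5-t13's unconditional `PMBaseKit.DThetaEllBridge.inducesZeta`.

## What is proved (all one-liners over landed theorems; binders BY NAME exactly as the kit they decorate)
* `inducesZeta_baseKitOfData` / `xiGroupCompat_baseKitOfData` / `prop65i_baseKitOfData` — the record kit over any `(V, bad, arc, δ)`;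
  `…_baseKitNFOfData` — its NF-widened twin (abc-iut-L5-t4 `PiAvatarBaseKitNF`).
* `…_baseKit` (p445979: `B CG hS hsurj hA Λ`), `…_baseKitNF`.
* `…_baseKitOfTorsionMonodromy` (p446463: `CG hS M hA hI B hsign ΛBad`), `…_baseKitOfBadPairs` / `…_baseKitStandIn` (p448457),
  `…_baseKitArrowStandIn` (p447892), `…_baseKitNFOfBadPairs` / `…_baseKitNFStandIn`.
* `prop65i_baseKitOfTorsionMonodromy_unramified` — the IUTchI:Prop6.5(i) conjunct of the L5 certificate of record
  `Summit.ABC.IUTFork.Conditional.layer5_held_sec6_v10_genuineKit_unramified` (p449860) AS A NAMED THEOREM with the same binders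
  DATA `D CG M' B` · LAWS `hS hL ΛBad` (abc-iut-L5-t8 `UnramifiedTorsionMonodromy`, abc-iut-L5-t1 `ModLCuspLaws` via
  `arrowCoveringClaims_pe_of_modLCuspLaws`, abc-iut-L5-d5 `localArrowLaw_L2_sign_local`), by the (α) route.
Proof-only: no `def`, no `instance`, no `notation`, no new `Prop` fact; typed ≠ inhabited ≠ proved; a binder is an assumption label.
HONEST FRAMING: nothing here asserts that abc is proved or refuted; establishment = OUR kernel check only.
-/

namespace Literature.IUT.HodgeTheaters

open CategoryTheory

universe u v w

section Prop65iAtGenuineKits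

variable {F : Type u} {K : Type v} {Fbar : Type w} [Field F] [NumberField F] [Field K] [NumberField K]
  [Algebra F K] [Field Fbar] [Algebra F Fbar] [Algebra K Fbar]
  {E : WeierstrassCurve F} [E.IsElliptic] {l : ℕ} {Pb : BadPlacePredicates K}
  (D : InitialThetaData F K Fbar E l Pb) (CG : D.geom.pe.CuspGalois) (hS : D.CuspClassesNormaliserStable) [Fact l.Prime]

namespace InitialThetaData

/-! ### The record kits `baseKitOfData` / `baseKitNFOfData` over arbitrary place data -/

section OfData

variable [(D.PiXund.subgroupOf D.PiXK).Normal] (hsurj : Function.Surjective D.toFlStarGlobal)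
  {V : Type} [DecidableEq V] (bad arc : Finset V) (δ : V → D.LocalDatum CG hS)

/-- **[IUTchI] Prop 6.5 (i), first sentence, at the record kit `baseKitOfData`**: every `𝒟-Θ^{ell}`-bridge induces the bijections
`†ζ^{Θell}_{v_t}` (abc-iut-L5-t13's unconditional `PMBaseKit.DThetaEllBridge.inducesZeta`). ([IUTchI] Prop 6.5 (i) p.163) [claim: Mochizuki2012, status: disputed] -/
theorem inducesZeta_baseKitOfData (Bθ : (D.baseKitOfData CG hS hsurj bad arc δ).DThetaEllBridge) : Bθ.InducesZeta :=
  PMBaseKit.DThetaEllBridge.inducesZeta Bθ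

/-- **[IUTchI] Prop 6.5 (i), second sentence, at the record kit `baseKitOfData`**: the bijections `†ξ^{Θell}_{v_t,w_t}` are compatible with the
`𝔽_l^±`-GROUP structures — from the (α) law `phiEllSync_baseKitOfData` (abc-iut-L5-t4 p444756) via `xiGroupCompat_of_sync`.
([IUTchI] Prop 6.5 (i) p.164) [claim: Mochizuki2012, status: disputed] -/
theorem xiGroupCompat_baseKitOfData (Bθ : (D.baseKitOfData CG hS hsurj bad arc δ).DThetaEllBridge) : Bθ.XiGroupCompat :=
  PMBaseKit.DThetaEllBridge.xiGroupCompat_of_sync (D.phiEllSync_baseKitOfData CG hS hsurj bad arc δ) Bθ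

/-- **[IUTchI] Prop 6.5 (i) (both sentences) at the record kit `baseKitOfData`.** ([IUTchI] Prop 6.5 (i) pp.163-164) [claim: Mochizuki2012, status: disputed] -/
theorem prop65i_baseKitOfData :
    (∀ Bθ : (D.baseKitOfData CG hS hsurj bad arc δ).DThetaEllBridge, Bθ.InducesZeta) ∧
      ∀ Bθ : (D.baseKitOfData CG hS hsurj bad arc δ).DThetaEllBridge, Bθ.XiGroupCompat :=
  ⟨D.inducesZeta_baseKitOfData CG hS hsurj bad arc δ, D.xiGroupCompat_baseKitOfData CG hS hsurj bad arc δ⟩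

/-- **[IUTchI] Prop 6.5 (i), first sentence, at the NF-widened record kit `baseKitNFOfData`.** ([IUTchI] Prop 6.5 (i) p.163) [claim: Mochizuki2012, status: disputed] -/
theorem inducesZeta_baseKitNFOfData (Bθ : (D.baseKitNFOfData CG hS hsurj bad arc δ).DThetaEllBridge) : Bθ.InducesZeta :=
  PMBaseKit.DThetaEllBridge.inducesZeta Bθ

/-- **[IUTchI] Prop 6.5 (i), second sentence, at the NF-widened record kit `baseKitNFOfData`** (from (α) `phiEllSync_baseKitNFOfData`).
([IUTchI] Prop 6.5 (i) p.164) [claim: Mochizuki2012, status: disputed] -/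
theorem xiGroupCompat_baseKitNFOfData (Bθ : (D.baseKitNFOfData CG hS hsurj bad arc δ).DThetaEllBridge) : Bθ.XiGroupCompat :=
  PMBaseKit.DThetaEllBridge.xiGroupCompat_of_sync (D.phiEllSync_baseKitNFOfData CG hS hsurj bad arc δ) Bθ

end OfData

/-! ### The genuine kits over `V̲`: `baseKit` (p445979) and `baseKitNF` -/

section OverPlaces

variable (B : ∀ v, v ∈ D.indexCopyBad → D.BadPairAt v) [(D.PiXund.subgroupOf D.PiXK).Normal]
  (hsurj : Function.Surjective D.toFlStarGlobal) (hA : D.geom.pe.ArrowCoveringClaims)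
  (Λ : ∀ v, D.LocalArrowLaw CG hS (D.localGroupAt B v))

/-- **[IUTchI] Prop 6.5 (i), first sentence, at the genuine kit `baseKit`** of the initial Θ-data. ([IUTchI] Prop 6.5 (i) p.163) [claim: Mochizuki2012, status: disputed] -/
theorem inducesZeta_baseKit (Bθ : (D.baseKit B CG hS hsurj hA Λ).DThetaEllBridge) : Bθ.InducesZeta :=
  PMBaseKit.DThetaEllBridge.inducesZeta Bθ

/-- **[IUTchI] Prop 6.5 (i), second sentence, at the genuine kit `baseKit`** (from (α) `phiEllSync_baseKit`, abc-iut-L5-t4 p445979).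
([IUTchI] Prop 6.5 (i) p.164) [claim: Mochizuki2012, status: disputed] -/
theorem xiGroupCompat_baseKit (Bθ : (D.baseKit B CG hS hsurj hA Λ).DThetaEllBridge) : Bθ.XiGroupCompat :=
  PMBaseKit.DThetaEllBridge.xiGroupCompat_of_sync (D.phiEllSync_baseKit B CG hS hsurj hA Λ) Bθ

/-- **[IUTchI] Prop 6.5 (i) (both sentences) at the genuine kit `baseKit`.** ([IUTchI] Prop 6.5 (i) pp.163-164) [claim: Mochizuki2012, status: disputed] -/
theorem prop65i_baseKit :
    (∀ Bθ : (D.baseKit B CG hS hsurj hA Λ).DThetaEllBridge, Bθ.InducesZeta) ∧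
      ∀ Bθ : (D.baseKit B CG hS hsurj hA Λ).DThetaEllBridge, Bθ.XiGroupCompat :=
  ⟨D.inducesZeta_baseKit CG hS B hsurj hA Λ, D.xiGroupCompat_baseKit CG hS B hsurj hA Λ⟩

/-- **[IUTchI] Prop 6.5 (i), first sentence, at the NF-widened genuine kit `baseKitNF`.** ([IUTchI] Prop 6.5 (i) p.163) [claim: Mochizuki2012, status: disputed] -/
theorem inducesZeta_baseKitNF (Bθ : (D.baseKitNF B CG hS hsurj hA Λ).DThetaEllBridge) : Bθ.InducesZeta :=
  PMBaseKit.DThetaEllBridge.inducesZeta Bθ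

/-- **[IUTchI] Prop 6.5 (i), second sentence, at the NF-widened genuine kit `baseKitNF`** (from (α) `phiEllSync_baseKitNF`).
([IUTchI] Prop 6.5 (i) p.164) [claim: Mochizuki2012, status: disputed] -/
theorem xiGroupCompat_baseKitNF (Bθ : (D.baseKitNF B CG hS hsurj hA Λ).DThetaEllBridge) : Bθ.XiGroupCompat :=
  PMBaseKit.DThetaEllBridge.xiGroupCompat_of_sync (D.phiEllSync_baseKitNF B CG hS hsurj hA Λ) Bθ

end OverPlaces

/-! ### The minimally-bound kits from a torsion-monodromy datum (p446463 / p448457 / p447892 / NF instances) -/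

section OfTorsionMonodromy

variable (M : D.TorsionMonodromy) (hA : D.geom.pe.ArrowCoveringClaims)
  (hI : ∀ k ∈ D.geom.pe.inertia D.geom.pe.ε1, M.tau (D.geom.embK k) = 0)

section WithSign

variable (B : ∀ v, v ∈ D.indexCopyBad → D.BadPairAt v)
  (hsign : ∀ v : D.IndexCopy, v ∉ D.indexCopyBad → ∀ n : D.PiC,
    n ∈ Subgroup.normalizer ((D.PiXarrow ⊓ (D.decompAt v).comap D.augGF : Subgroup D.PiC) : Set D.PiC) →
      ∀ hn : n ∈ Subgroup.normalizer ((D.PiXund : Subgroup D.PiC) : Set D.PiC),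
        ∃ ε : ℤˣ, ∀ x, D.gChart₀Model CG (D.actF CG hS ⟨n, hn⟩ x) = ε • D.gChart₀Model CG x)
  (ΛBad : ∀ v (h : v ∈ D.indexCopyBad), D.LocalArrowLaw CG hS (B v h).H)

/-- **[IUTchI] Prop 6.5 (i), first sentence, at `baseKitOfTorsionMonodromy`** (abc-iut-L5-t4 p446463). ([IUTchI] Prop 6.5 (i) p.163) [claim: Mochizuki2012, status: disputed] -/
theorem inducesZeta_baseKitOfTorsionMonodromy
    (Bθ : (D.baseKitOfTorsionMonodromy CG hS M hA hI B hsign ΛBad).DThetaEllBridge) : Bθ.InducesZeta :=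
  PMBaseKit.DThetaEllBridge.inducesZeta Bθ

/-- **[IUTchI] Prop 6.5 (i), second sentence, at `baseKitOfTorsionMonodromy`** (from (α) `phiEllSync_baseKitOfTorsionMonodromy`).
([IUTchI] Prop 6.5 (i) p.164) [claim: Mochizuki2012, status: disputed] -/
theorem xiGroupCompat_baseKitOfTorsionMonodromy
    (Bθ : (D.baseKitOfTorsionMonodromy CG hS M hA hI B hsign ΛBad).DThetaEllBridge) : Bθ.XiGroupCompat :=
  PMBaseKit.DThetaEllBridge.xiGroupCompat_of_sync (D.phiEllSync_baseKitOfTorsionMonodromy CG hS M hA hI B hsign ΛBad) Bθ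

/-- **[IUTchI] Prop 6.5 (i) (both sentences) at `baseKitOfTorsionMonodromy`.** ([IUTchI] Prop 6.5 (i) pp.163-164) [claim: Mochizuki2012, status: disputed] -/
theorem prop65i_baseKitOfTorsionMonodromy :
    (∀ Bθ : (D.baseKitOfTorsionMonodromy CG hS M hA hI B hsign ΛBad).DThetaEllBridge, Bθ.InducesZeta) ∧
      ∀ Bθ : (D.baseKitOfTorsionMonodromy CG hS M hA hI B hsign ΛBad).DThetaEllBridge, Bθ.XiGroupCompat :=
  ⟨D.inducesZeta_baseKitOfTorsionMonodromy CG hS M hA hI B hsign ΛBad,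
    D.xiGroupCompat_baseKitOfTorsionMonodromy CG hS M hA hI B hsign ΛBad⟩

end WithSign

section BadPairs

variable (B : ∀ v, v ∈ D.indexCopyBad → D.BadPairAt v) (ΛBad : ∀ v (h : v ∈ D.indexCopyBad), D.LocalArrowLaw CG hS (B v h).H)

/-- **[IUTchI] Prop 6.5 (i), first sentence, at `baseKitOfBadPairs`** (abc-iut-L5-t4 p448457: the (L2) sign DERIVED, binders
`CG hS M hA hI B ΛBad`). ([IUTchI] Prop 6.5 (i) p.163) [claim: Mochizuki2012, status: disputed] -/
theorem inducesZeta_baseKitOfBadPairs (Bθ : (D.baseKitOfBadPairs CG hS M hA hI B ΛBad).DThetaEllBridge) : Bθ.InducesZeta :=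
  PMBaseKit.DThetaEllBridge.inducesZeta Bθ

/-- **[IUTchI] Prop 6.5 (i), second sentence, at `baseKitOfBadPairs`** (from (α) `phiEllSync_baseKitOfBadPairs`).
([IUTchI] Prop 6.5 (i) p.164) [claim: Mochizuki2012, status: disputed] -/
theorem xiGroupCompat_baseKitOfBadPairs (Bθ : (D.baseKitOfBadPairs CG hS M hA hI B ΛBad).DThetaEllBridge) : Bθ.XiGroupCompat :=
  PMBaseKit.DThetaEllBridge.xiGroupCompat_of_sync (D.phiEllSync_baseKitOfBadPairs CG hS M hA hI B ΛBad) Bθ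

/-- **[IUTchI] Prop 6.5 (i) (both sentences) at `baseKitOfBadPairs`.** ([IUTchI] Prop 6.5 (i) pp.163-164) [claim: Mochizuki2012, status: disputed] -/
theorem prop65i_baseKitOfBadPairs :
    (∀ Bθ : (D.baseKitOfBadPairs CG hS M hA hI B ΛBad).DThetaEllBridge, Bθ.InducesZeta) ∧
      ∀ Bθ : (D.baseKitOfBadPairs CG hS M hA hI B ΛBad).DThetaEllBridge, Bθ.XiGroupCompat :=
  ⟨D.inducesZeta_baseKitOfBadPairs CG hS M hA hI B ΛBad, D.xiGroupCompat_baseKitOfBadPairs CG hS M hA hI B ΛBad⟩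

/-- **[IUTchI] Prop 6.5 (i), first sentence, at the NF-widened `baseKitNFOfBadPairs`.** ([IUTchI] Prop 6.5 (i) p.163) [claim: Mochizuki2012, status: disputed] -/
theorem inducesZeta_baseKitNFOfBadPairs (Bθ : (D.baseKitNFOfBadPairs CG hS M hA hI B ΛBad).DThetaEllBridge) : Bθ.InducesZeta :=
  PMBaseKit.DThetaEllBridge.inducesZeta Bθ

/-- **[IUTchI] Prop 6.5 (i), second sentence, at the NF-widened `baseKitNFOfBadPairs`** (from (α) `phiEllSync_baseKitNFOfBadPairs`).
([IUTchI] Prop 6.5 (i) p.164) [claim: Mochizuki2012, status: disputed] -/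
theorem xiGroupCompat_baseKitNFOfBadPairs (Bθ : (D.baseKitNFOfBadPairs CG hS M hA hI B ΛBad).DThetaEllBridge) :
    Bθ.XiGroupCompat :=
  PMBaseKit.DThetaEllBridge.xiGroupCompat_of_sync (D.phiEllSync_baseKitNFOfBadPairs CG hS M hA hI B ΛBad) Bθ

end BadPairs

/-- **[IUTchI] Prop 6.5 (i), first sentence, at the stand-in kit `baseKitStandIn`** (abc-iut-L5-t4 p448457, binders `CG hS M hA hI`;
honesty tag of that file: bad-place `𝒟_v̲` is a profinite STAND-IN). ([IUTchI] Prop 6.5 (i) p.163) [claim: Mochizuki2012, status: disputed] -/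
theorem inducesZeta_baseKitStandIn (Bθ : (D.baseKitStandIn CG hS M hA hI).DThetaEllBridge) : Bθ.InducesZeta :=
  PMBaseKit.DThetaEllBridge.inducesZeta Bθ

/-- **[IUTchI] Prop 6.5 (i), second sentence, at the stand-in kit `baseKitStandIn`** (from (α) `phiEllSync_baseKitStandIn`).
([IUTchI] Prop 6.5 (i) p.164) [claim: Mochizuki2012, status: disputed] -/
theorem xiGroupCompat_baseKitStandIn (Bθ : (D.baseKitStandIn CG hS M hA hI).DThetaEllBridge) : Bθ.XiGroupCompat :=
  PMBaseKit.DThetaEllBridge.xiGroupCompat_of_sync (D.phiEllSync_baseKitStandIn CG hS M hA hI) Bθ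

/-- **[IUTchI] Prop 6.5 (i) (both sentences) at the stand-in kit `baseKitStandIn`.** ([IUTchI] Prop 6.5 (i) pp.163-164) [claim: Mochizuki2012, status: disputed] -/
theorem prop65i_baseKitStandIn :
    (∀ Bθ : (D.baseKitStandIn CG hS M hA hI).DThetaEllBridge, Bθ.InducesZeta) ∧
      ∀ Bθ : (D.baseKitStandIn CG hS M hA hI).DThetaEllBridge, Bθ.XiGroupCompat :=
  ⟨D.inducesZeta_baseKitStandIn CG hS M hA hI, D.xiGroupCompat_baseKitStandIn CG hS M hA hI⟩

/-- **[IUTchI] Prop 6.5 (i), first sentence, at the NF-widened stand-in kit `baseKitNFStandIn`.** ([IUTchI] Prop 6.5 (i) p.163) [claim: Mochizuki2012, status: disputed] -/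
theorem inducesZeta_baseKitNFStandIn (Bθ : (D.baseKitNFStandIn CG hS M hA hI).DThetaEllBridge) : Bθ.InducesZeta :=
  PMBaseKit.DThetaEllBridge.inducesZeta Bθ

/-- **[IUTchI] Prop 6.5 (i), second sentence, at the NF-widened stand-in kit `baseKitNFStandIn`** (from (α) `phiEllSync_baseKitNFStandIn`).
([IUTchI] Prop 6.5 (i) p.164) [claim: Mochizuki2012, status: disputed] -/
theorem xiGroupCompat_baseKitNFStandIn (Bθ : (D.baseKitNFStandIn CG hS M hA hI).DThetaEllBridge) : Bθ.XiGroupCompat :=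
  PMBaseKit.DThetaEllBridge.xiGroupCompat_of_sync (D.phiEllSync_baseKitNFStandIn CG hS M hA hI) Bθ

section ArrowStandIn

variable (hsign : ∀ v : D.IndexCopy, ∀ n : D.PiC,
    n ∈ Subgroup.normalizer ((D.PiXarrow ⊓ (D.decompAt v).comap D.augGF : Subgroup D.PiC) : Set D.PiC) →
      ∀ hn : n ∈ Subgroup.normalizer ((D.PiXund : Subgroup D.PiC) : Set D.PiC),
        ∃ ε : ℤˣ, ∀ x, D.gChart₀Model CG (D.actF CG hS ⟨n, hn⟩ x) = ε • D.gChart₀Model CG x)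

/-- **[IUTchI] Prop 6.5 (i), first sentence, at the arrow stand-in kit `baseKitArrowStandIn`** (abc-iut-L5-t4 p447892, binders
`hA CG hS M hI hsign`). ([IUTchI] Prop 6.5 (i) p.163) [claim: Mochizuki2012, status: disputed] -/
theorem inducesZeta_baseKitArrowStandIn (Bθ : (D.baseKitArrowStandIn hA CG hS M hI hsign).DThetaEllBridge) : Bθ.InducesZeta :=
  PMBaseKit.DThetaEllBridge.inducesZeta Bθ

/-- **[IUTchI] Prop 6.5 (i), second sentence, at the arrow stand-in kit `baseKitArrowStandIn`** (from (α) `phiEllSync_baseKitArrowStandIn`).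
([IUTchI] Prop 6.5 (i) p.164) [claim: Mochizuki2012, status: disputed] -/
theorem xiGroupCompat_baseKitArrowStandIn (Bθ : (D.baseKitArrowStandIn hA CG hS M hI hsign).DThetaEllBridge) : Bθ.XiGroupCompat :=
  PMBaseKit.DThetaEllBridge.xiGroupCompat_of_sync (D.phiEllSync_baseKitArrowStandIn hA CG hS M hI hsign) Bθ

/-- **[IUTchI] Prop 6.5 (i) (both sentences) at the arrow stand-in kit `baseKitArrowStandIn`.** ([IUTchI] Prop 6.5 (i) pp.163-164) [claim: Mochizuki2012, status: disputed] -/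
theorem prop65i_baseKitArrowStandIn :
    (∀ Bθ : (D.baseKitArrowStandIn hA CG hS M hI hsign).DThetaEllBridge, Bθ.InducesZeta) ∧
      ∀ Bθ : (D.baseKitArrowStandIn hA CG hS M hI hsign).DThetaEllBridge, Bθ.XiGroupCompat :=
  ⟨D.inducesZeta_baseKitArrowStandIn CG hS M hA hI hsign, D.xiGroupCompat_baseKitArrowStandIn CG hS M hA hI hsign⟩

end ArrowStandIn

end OfTorsionMonodromy

/-! ### The IUTchI:Prop6.5(i) conjunct of the L5 certificate of record, as a named theorem ((α) route, no parity side condition) -/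

/-- **[IUTchI] Prop 6.5 (i) at the certificate's kit** — the kit expression of `Summit.ABC.IUTFork.Conditional.layer5_held_sec6_v10_genuineKit_unramified`
(abc-iut-L5-d1 g6, p449860): `baseKitOfTorsionMonodromy` at the UNRAMIFIED datum `M'` (abc-iut-L5-t8 `UnramifiedTorsionMonodromy`, `hI := M'.tau_inertia_ε1`),
`hA := arrowCoveringClaims_pe_of_modLCuspLaws CG hL` (abc-iut-L5-t1 p448117), good-place signs `localArrowLaw_L2_sign_local` (abc-iut-L5-d5 p446471).
Binders DATA `D CG M' B` · LAWS `hS hL ΛBad`, exactly the certificate's; the certificate proves this conjunct inline by the (β) route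
(`xiGroupCompat_of_negCompatModel`, `l ≠ 2 ⇐ five_le_l`), here it is the (α) route BY NAME. ([IUTchI] Prop 6.5 (i) pp.163-164) [claim: Mochizuki2012, status: disputed] -/
theorem prop65i_baseKitOfTorsionMonodromy_unramified (M' : D.UnramifiedTorsionMonodromy)
    (B : ∀ v, v ∈ D.indexCopyBad → D.BadPairAt v) (hL : D.geom.pe.ModLCuspLaws)
    (ΛBad : ∀ v (h : v ∈ D.indexCopyBad), D.LocalArrowLaw CG hS (B v h).H) :
    (∀ Bθ : (D.baseKitOfTorsionMonodromy CG hS M'.toTorsionMonodromy (D.arrowCoveringClaims_pe_of_modLCuspLaws CG hL)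
        M'.tau_inertia_ε1 B
        (fun v _ => D.localArrowLaw_L2_sign_local CG hS (D.arrowCoveringClaims_pe_of_modLCuspLaws CG hL) (D.decompAt v)) ΛBad).DThetaEllBridge,
        Bθ.InducesZeta) ∧
      ∀ Bθ : (D.baseKitOfTorsionMonodromy CG hS M'.toTorsionMonodromy (D.arrowCoveringClaims_pe_of_modLCuspLaws CG hL)
        M'.tau_inertia_ε1 B
        (fun v _ => D.localArrowLaw_L2_sign_local CG hS (D.arrowCoveringClaims_pe_of_modLCuspLaws CG hL) (D.decompAt v)) ΛBad).DThetaEllBridge,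
        Bθ.XiGroupCompat :=
  D.prop65i_baseKitOfTorsionMonodromy CG hS M'.toTorsionMonodromy (D.arrowCoveringClaims_pe_of_modLCuspLaws CG hL) M'.tau_inertia_ε1 B
    (fun v _ => D.localArrowLaw_L2_sign_local CG hS (D.arrowCoveringClaims_pe_of_modLCuspLaws CG hL) (D.decompAt v)) ΛBad

end InitialThetaData

end Prop65iAtGenuineKits

end Literature.IUT.HodgeTheaters
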